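import Mathlib

/-!
# Low-density asymptotics — stub `stub_lowDensityAsymptotics` of line `Sketch`,
# crux stmt-PneNP-2463 (`SolvableImpliesStableSection`)

Pure real analysis for the low clause-density block (`k ≥ 3`, `α ≤ 1/(32k²)`, `m = ⌊α n⌋₊`
clauses, `u = 2·log₂ n + 4`).  Eventually in `n`:

* (i)  `k (m k + 1) · Σ_{c=2}^{m} C(m,c) C(n,c-1) ((c-1)/n)^{kc} ≤ 1/4` (first moment for a
  Hall-violating splice instance): each term is at most `e² α² / n³`, using
  `C(a,b) ≤ a^b/b!`, `x^j/j! ≤ e^x`, `(c-1)³ ≤ 8^{c-2}` and `e² α (c-1)/n ≤ e² α² ≤ 1/8`;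
* (ii) `k · m^u · 4^u · ((2k)²/n)^{u-1} ≤ 1/4` (first moment for a large pooled component):
  the left side is `4km (16k²m/n)^{u-1} ≤ 4kαn (1/2)^{2 log₂ n + 3} ≤ 2kα/n`;
* (iii) `2k·u ≤ η n` (`log = o(id)`), (iv) `e^{-cn} ≤ 1/2`, (v) `m ≤ n` and `1 ≤ n`.

It is consumed by `stub_lowDensityAssembly`.
-/

set_option linter.dupNamespace false

namespace Summit.PneNP.PneNP.Cruxes.SolvableImpliesStableSection.Sketch

open Finset
open scoped Classical

/-- `(i+1)³ ≤ 8^i`, from `i + 1 ≤ 2^i`. -/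
private theorem lda_cube_le (i : ℕ) : (((i + 1 : ℕ) : ℝ)) ^ 3 ≤ 8 ^ i := by
  have h : ((i + 1 : ℕ) : ℝ) ≤ 2 ^ i := by
    exact_mod_cast Nat.succ_le_of_lt (Nat.lt_two_pow_self (n := i))
  calc (((i + 1 : ℕ) : ℝ)) ^ 3 ≤ ((2 : ℝ) ^ i) ^ 3 := pow_le_pow_left₀ (by positivity) h 3
    _ = 8 ^ i := by rw [← pow_mul, mul_comm, pow_mul]; norm_num

/-- Core estimate behind the per-term bound of (i), in abstract variables: if `0 ≤ J ≤ M ≤ α N`,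
`J³ ≤ 8^i` and `E α² ≤ 1/8`, then `E^{i+1} M^{i+2} N^{i+1} J^{i+3} / N^{3(i+2)} ≤ E α² / N³`
(write the left side as `(E α²/N³) · (EαJ/N)^i · J³` and use `EαJ/N ≤ Eα² ≤ 1/8`). -/
private theorem lda_core {E α M N J : ℝ} {i : ℕ} (hE : 0 < E) (hα : 0 < α) (hN : 0 < N)
    (hJ0 : 0 ≤ J) (hJM : J ≤ M) (hM : M ≤ α * N) (hJ8 : J ^ 3 ≤ 8 ^ i)
    (hα8 : E * α ^ 2 ≤ 1 / 8) :
    E ^ (i + 1) * (M ^ (i + 2) * N ^ (i + 1) * J ^ (i + 3) / N ^ (3 * (i + 2))) ≤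
      E * α ^ 2 / N ^ 3 := by
  have hN0 : N ≠ 0 := hN.ne'
  have hM0 : 0 ≤ M := hJ0.trans hJM
  have hx : E * α * J / N ≤ 1 / 8 := by
    rw [div_le_iff₀ hN]
    calc E * α * J ≤ E * α * (α * N) := by gcongr; exact hJM.trans hM
      _ = E * α ^ 2 * N := by ring
      _ ≤ 1 / 8 * N := by gcongr
  calc E ^ (i + 1) * (M ^ (i + 2) * N ^ (i + 1) * J ^ (i + 3) / N ^ (3 * (i + 2)))
      ≤ E ^ (i + 1) * ((α * N) ^ (i + 2) * N ^ (i + 1) * J ^ (i + 3) / N ^ (3 * (i + 2))) := by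
        gcongr
    _ = (E * α ^ 2 / N ^ 3) * ((E * α * J / N) ^ i * J ^ 3) := by
        rw [div_pow]; field_simp; ring
    _ ≤ (E * α ^ 2 / N ^ 3) * 1 := by
        gcongr
        calc (E * α * J / N) ^ i * J ^ 3 ≤ (1 / 8) ^ i * 8 ^ i :=
              mul_le_mul (pow_le_pow_left₀ (by positivity) hx i) hJ8 (by positivity)
                (by positivity)
          _ = 1 := by rw [← mul_pow]; norm_num
    _ = E * α ^ 2 / N ^ 3 := mul_one _

/-- Per-term bound for (i): for `2 ≤ c ≤ m ≤ n`, `k ≥ 3`, `m ≤ α n` and `e² α² ≤ 1/8`,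
`C(m,c) C(n,c-1) ((c-1)/n)^{kc} ≤ e² α² / n³`.  Proof: `C(m,c) ≤ m^c/c!`,
`C(n,c-1) ≤ n^{c-1}/(c-1)!`, `((c-1)/n)^{kc} ≤ ((c-1)/n)^{3c}`, then
`(c-1)^c/c! ≤ e^{c-1}`, `(c-1)^{c-1}/(c-1)! ≤ e^{c-1}` and `lda_core`. -/
private theorem lda_term {k m n c : ℕ} {α : ℝ} (hk : 3 ≤ k) (hα : 0 < α) (hc : 2 ≤ c)
    (hcm : c ≤ m) (hmn : m ≤ n) (hm : (m : ℝ) ≤ α * n) (hα8 : Real.exp 2 * α ^ 2 ≤ 1 / 8) :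
    ((m.choose c : ℕ) : ℝ) * ((n.choose (c - 1) : ℕ) : ℝ) * (((c - 1 : ℕ) : ℝ) / n) ^ (k * c) ≤
      Real.exp 2 * α ^ 2 / (n : ℝ) ^ 3 := by
  obtain ⟨i, rfl⟩ : ∃ i, c = i + 2 := ⟨c - 2, by omega⟩
  have h1 : i + 2 - 1 = i + 1 := by omega
  simp only [h1]
  have hN : (0 : ℝ) < n := by exact_mod_cast (show 0 < n by omega)
  have hN0 : (n : ℝ) ≠ 0 := hN.ne'
  have hMN : (m : ℝ) ≤ n := by exact_mod_cast hmn
  have hJM : ((i + 1 : ℕ) : ℝ) ≤ m := by exact_mod_cast (show i + 1 ≤ m by omega)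
  have hJ0 : (0 : ℝ) ≤ ((i + 1 : ℕ) : ℝ) := Nat.cast_nonneg _
  have hJN0 : 0 ≤ ((i + 1 : ℕ) : ℝ) / n := div_nonneg hJ0 hN.le
  have hJN1 : ((i + 1 : ℕ) : ℝ) / n ≤ 1 := div_le_one_of_le₀ (hJM.trans hMN) hN.le
  have hEJ : Real.exp ((i + 1 : ℕ) : ℝ) * Real.exp ((i + 1 : ℕ) : ℝ) =
      Real.exp 2 ^ (i + 1) := by
    rw [← Real.exp_add, ← Real.exp_nat_mul]; congr 1; ring
  calc ((m.choose (i + 2) : ℕ) : ℝ) * ((n.choose (i + 1) : ℕ) : ℝ) *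
        (((i + 1 : ℕ) : ℝ) / n) ^ (k * (i + 2))
      ≤ ((m : ℝ) ^ (i + 2) / (i + 2).factorial) * ((n : ℝ) ^ (i + 1) / (i + 1).factorial) *
        (((i + 1 : ℕ) : ℝ) / n) ^ (3 * (i + 2)) :=
        mul_le_mul (mul_le_mul (Nat.choose_le_pow_div (i + 2) m)
          (Nat.choose_le_pow_div (i + 1) n) (by positivity) (by positivity))
          (pow_le_pow_of_le_one hJN0 hJN1 (Nat.mul_le_mul_right _ hk)) (by positivity)
          (by positivity)
    _ = (((i + 1 : ℕ) : ℝ) ^ (i + 2) / (i + 2).factorial) *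
        ((((i + 1 : ℕ) : ℝ)) ^ (i + 1) / (i + 1).factorial) *
        ((m : ℝ) ^ (i + 2) * (n : ℝ) ^ (i + 1) * ((i + 1 : ℕ) : ℝ) ^ (i + 3) /
          (n : ℝ) ^ (3 * (i + 2))) := by
        rw [div_pow]; field_simp; ring
    _ ≤ Real.exp ((i + 1 : ℕ) : ℝ) * Real.exp ((i + 1 : ℕ) : ℝ) *
        ((m : ℝ) ^ (i + 2) * (n : ℝ) ^ (i + 1) * ((i + 1 : ℕ) : ℝ) ^ (i + 3) /
          (n : ℝ) ^ (3 * (i + 2))) := by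
        gcongr
        · exact Real.pow_div_factorial_le_exp _ hJ0 (i + 2)
        · exact Real.pow_div_factorial_le_exp _ hJ0 (i + 1)
    _ = Real.exp 2 ^ (i + 1) *
        ((m : ℝ) ^ (i + 2) * (n : ℝ) ^ (i + 1) * ((i + 1 : ℕ) : ℝ) ^ (i + 3) /
          (n : ℝ) ^ (3 * (i + 2))) := by
        rw [hEJ]
    _ ≤ Real.exp 2 * α ^ 2 / (n : ℝ) ^ 3 :=
        lda_core (Real.exp_pos 2) hα hN hJ0 hJM hm (lda_cube_le i) hα8

/-- Conjunct (i), pointwise: with `m ≤ α n`, `m ≤ n`, `1 ≤ n`, `e² α² ≤ 1/8` and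
`n ≥ 4 e² α³ k (α k + 1)`, the Hall first moment `k (m k + 1) Σ_c (term c)` is at most `1/4`
(at most `m ≤ α n` terms, each `≤ e² α²/n³` by `lda_term`). -/
private theorem lda_conj1 {k m n : ℕ} {α : ℝ} (hk : 3 ≤ k) (hα : 0 < α)
    (hα8 : Real.exp 2 * α ^ 2 ≤ 1 / 8) (hn : 1 ≤ n) (hmn : m ≤ n) (hm : (m : ℝ) ≤ α * n)
    (hbig : 4 * Real.exp 2 * α ^ 3 * k * (α * k + 1) ≤ n) :
    (k : ℝ) * ((m : ℝ) * k + 1) *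
        (∑ c' ∈ Finset.Icc 2 m, ((m.choose c' : ℕ) : ℝ) *
          ((n.choose (c' - 1) : ℕ) : ℝ) * (((c' - 1 : ℕ) : ℝ) / n) ^ (k * c')) ≤ 1 / 4 := by
  have hN : (0 : ℝ) < n := by exact_mod_cast hn
  have hN1 : (1 : ℝ) ≤ n := by exact_mod_cast hn
  have hsum : (∑ c' ∈ Finset.Icc 2 m, ((m.choose c' : ℕ) : ℝ) *
        ((n.choose (c' - 1) : ℕ) : ℝ) * (((c' - 1 : ℕ) : ℝ) / n) ^ (k * c')) ≤
      α * n * (Real.exp 2 * α ^ 2 / (n : ℝ) ^ 3) := by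
    calc (∑ c' ∈ Finset.Icc 2 m, ((m.choose c' : ℕ) : ℝ) *
          ((n.choose (c' - 1) : ℕ) : ℝ) * (((c' - 1 : ℕ) : ℝ) / n) ^ (k * c'))
        ≤ (Finset.Icc 2 m).card • (Real.exp 2 * α ^ 2 / (n : ℝ) ^ 3) := by
          refine Finset.sum_le_card_nsmul _ _ _ fun c hc => ?_
          rw [Finset.mem_Icc] at hc
          exact lda_term hk hα hc.1 hc.2 hmn hm hα8
      _ ≤ (m : ℝ) * (Real.exp 2 * α ^ 2 / (n : ℝ) ^ 3) := by
          rw [nsmul_eq_mul, Nat.card_Icc]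
          have h : (m + 1 - 2 : ℕ) ≤ m := by omega
          exact mul_le_mul_of_nonneg_right (by exact_mod_cast h) (by positivity)
      _ ≤ α * n * (Real.exp 2 * α ^ 2 / (n : ℝ) ^ 3) := by gcongr
  have hX : 0 ≤ (n : ℝ) * (n - 4 * Real.exp 2 * α ^ 3 * k * (α * k + 1)) :=
    mul_nonneg hN.le (by linarith)
  calc (k : ℝ) * ((m : ℝ) * k + 1) *
        (∑ c' ∈ Finset.Icc 2 m, ((m.choose c' : ℕ) : ℝ) *
          ((n.choose (c' - 1) : ℕ) : ℝ) * (((c' - 1 : ℕ) : ℝ) / n) ^ (k * c'))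
      ≤ (k : ℝ) * (α * n * k + 1) * (α * n * (Real.exp 2 * α ^ 2 / (n : ℝ) ^ 3)) := by
        gcongr
    _ = Real.exp 2 * α ^ 3 * k * (α * k * n + 1) / (n : ℝ) ^ 2 := by
        field_simp
    _ ≤ Real.exp 2 * α ^ 3 * k * ((α * k + 1) * n) / (n : ℝ) ^ 2 := by
        gcongr; linarith
    _ ≤ 1 / 4 := by
        rw [div_le_iff₀ (by positivity)]
        nlinarith [hX]

/-- The algebraic regrouping used for (ii): `K M^{v+1} q^{v+1} r^v = qKM · (qMr)^v`. -/
private theorem lda_geom_identity (K M q r : ℝ) (v : ℕ) :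
    K * M ^ (v + 1) * q ^ (v + 1) * r ^ v = q * K * M * (q * M * r) ^ v := by
  ring

/-- Conjunct (ii), pointwise: with `m ≤ α n`, `α ≤ 1/(32k²)`, `1 ≤ n` and `n ≥ 8kα`,
`k m^u 4^u ((2k)²/n)^{u-1} ≤ 1/4` for `u = 2 log₂ n + 4`: the left side equals
`4km (16k²m/n)^{u-1} ≤ 4kαn (1/2)^{2 log₂ n + 3} ≤ 2kα/n` as `n ≤ 2^{log₂ n + 1}`. -/
private theorem lda_conj2 {k m n : ℕ} {α : ℝ} (hk : 3 ≤ k) (hα : 0 < α)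
    (hαk : α ≤ 1 / (32 * (k : ℝ) ^ 2)) (hn : 1 ≤ n) (hm : (m : ℝ) ≤ α * n)
    (hbig : 8 * k * α ≤ n) :
    (k : ℝ) * (m : ℝ) ^ (2 * Nat.log 2 n + 4) * (4 : ℝ) ^ (2 * Nat.log 2 n + 4) *
        ((2 * k : ℝ) ^ 2 / n) ^ (2 * Nat.log 2 n + 4 - 1) ≤ 1 / 4 := by
  have hN : (0 : ℝ) < n := by exact_mod_cast hn
  have hk0 : (0 : ℝ) < k := by exact_mod_cast (show 0 < k by omega)
  have hu : 2 * Nat.log 2 n + 4 - 1 = 2 * Nat.log 2 n + 3 := by omega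
  have hu' : 2 * Nat.log 2 n + 4 = 2 * Nat.log 2 n + 3 + 1 := by omega
  rw [hu, hu', lda_geom_identity]
  have h16 : 16 * (k : ℝ) ^ 2 * α ≤ 1 / 2 := by
    calc 16 * (k : ℝ) ^ 2 * α ≤ 16 * (k : ℝ) ^ 2 * (1 / (32 * (k : ℝ) ^ 2)) := by gcongr
      _ = 1 / 2 := by field_simp; ring
  have hbase : 4 * (m : ℝ) * ((2 * k : ℝ) ^ 2 / n) ≤ 1 / 2 := by
    rw [show 4 * (m : ℝ) * ((2 * k : ℝ) ^ 2 / n) = 16 * (k : ℝ) ^ 2 * m / n by ring,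
      div_le_iff₀ hN]
    calc 16 * (k : ℝ) ^ 2 * m ≤ 16 * (k : ℝ) ^ 2 * (α * n) := by gcongr
      _ = 16 * (k : ℝ) ^ 2 * α * n := by ring
      _ ≤ 1 / 2 * n := by gcongr
  have hpow2 : (n : ℝ) ≤ 2 ^ (Nat.log 2 n + 1) := by
    exact_mod_cast (Nat.lt_pow_succ_log_self one_lt_two n).le
  have hhalf : (1 / 2 : ℝ) ^ (2 * Nat.log 2 n + 3) * (n : ℝ) ^ 2 ≤ 1 / 2 := by
    rw [one_div_pow, one_div_mul_eq_div, div_le_iff₀ (by positivity)]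
    calc (n : ℝ) ^ 2 ≤ (2 ^ (Nat.log 2 n + 1)) ^ 2 := by gcongr
      _ = 1 / 2 * 2 ^ (2 * Nat.log 2 n + 3) := by ring
  calc 4 * (k : ℝ) * m * (4 * (m : ℝ) * ((2 * k : ℝ) ^ 2 / n)) ^ (2 * Nat.log 2 n + 3)
      ≤ 4 * (k : ℝ) * (α * n) * (1 / 2) ^ (2 * Nat.log 2 n + 3) := by gcongr
    _ = 4 * k * α / n * ((1 / 2 : ℝ) ^ (2 * Nat.log 2 n + 3) * (n : ℝ) ^ 2) := by
        field_simp
    _ ≤ 4 * k * α / n * (1 / 2) := by gcongr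
    _ = 2 * k * α / n := by ring
    _ ≤ 1 / 4 := by
        rw [div_le_iff₀ hN]; linarith

/-- Conjunct (iii), in the form `A · log₂ n + B ≤ η n` eventually (`A, η > 0`): from
`2^{Nat.log 2 n} ≤ n` we get `(Nat.log 2 n) log 2 ≤ log n`, and `log x ≤ ε x` eventually
(`Real.isLittleO_log_id_atTop`). -/
private theorem lda_log_event {A B η : ℝ} (hA : 0 < A) (hη : 0 < η) :
    ∀ᶠ n : ℕ in Filter.atTop, A * (Nat.log 2 n : ℝ) + B ≤ η * n := by
  have hlog2 : 0 < Real.log 2 := Real.log_pos one_lt_two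
  have hε : 0 < η * Real.log 2 / (2 * A) := by positivity
  have hreal : ∀ᶠ x : ℝ in Filter.atTop, Real.log x ≤ η * Real.log 2 / (2 * A) * x := by
    filter_upwards [Real.isLittleO_log_id_atTop.bound hε, Filter.eventually_ge_atTop (0 : ℝ)]
      with x hx hx0
    have hx' : |Real.log x| ≤ η * Real.log 2 / (2 * A) * |x| := by
      simpa only [Real.norm_eq_abs, id] using hx
    rw [abs_of_nonneg hx0] at hx'
    exact (le_abs_self _).trans hx'
  filter_upwards [(tendsto_natCast_atTop_atTop (R := ℝ)).eventually hreal,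
    (tendsto_natCast_atTop_atTop (R := ℝ)).eventually_ge_atTop (2 * B / η),
    Filter.eventually_ge_atTop 1] with n hn hBn hn1
  have hL : (Nat.log 2 n : ℝ) * Real.log 2 ≤ Real.log n := by
    have h2 : (2 : ℝ) ^ Nat.log 2 n ≤ n := by
      exact_mod_cast Nat.pow_log_le_self 2 (show n ≠ 0 by omega)
    have h3 := Real.log_le_log (by positivity) h2
    rwa [Real.log_pow] at h3
  have h6 : A * (η * Real.log 2 / (2 * A) * n) = η * n / 2 * Real.log 2 := by
    field_simp
  have h5 : A * (Nat.log 2 n : ℝ) * Real.log 2 ≤ η * n / 2 * Real.log 2 := by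
    rw [mul_assoc, ← h6]
    exact mul_le_mul_of_nonneg_left (hL.trans hn) hA.le
  have h7 : A * (Nat.log 2 n : ℝ) ≤ η * n / 2 := le_of_mul_le_mul_right h5 hlog2
  have h8 : B ≤ η * n / 2 := by
    rw [div_le_iff₀ hη] at hBn
    linarith
  linarith

/-- Conjunct (iv): `e^{-cn} ≤ 1/2` as soon as `n ≥ log 2 / c`. -/
private theorem lda_exp_event {c : ℝ} (hc : 0 < c) :
    ∀ᶠ n : ℕ in Filter.atTop, Real.exp (-(c * n)) ≤ 1 / 2 := by
  filter_upwards [(tendsto_natCast_atTop_atTop (R := ℝ)).eventually_ge_atTop (Real.log 2 / c)]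
    with n hn
  have h : Real.log 2 ≤ c * n := by
    rw [div_le_iff₀ hc] at hn
    linarith
  calc Real.exp (-(c * n)) ≤ Real.exp (-Real.log 2) := Real.exp_le_exp.2 (neg_le_neg h)
    _ = 1 / 2 := by rw [Real.exp_neg, Real.exp_log two_pos, one_div]

/-- **Stub — low-density asymptotics.** For `k ≥ 3`, `0 < α ≤ 1/(32k²)`, `η, c > 0`,
eventually in `n` (with `m = ⌊α n⌋₊`, `u = 2 Nat.log 2 n + 4`): (i) the Hall first moment
`k(mk+1) Σ_{c'=2}^{m} C(m,c') C(n,c'-1) ((c'-1)/n)^{kc'} ≤ 1/4`; (ii) the large-component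
first moment `k m^u 4^u ((2k)²/n)^{u-1} ≤ 1/4`; (iii) `2k·u ≤ η n`; (iv) `e^{-cn} ≤ 1/2`;
(v) `m ≤ n` and `1 ≤ n`.  Each conjunct is reduced to an explicit lower bound on `n`
(`lda_conj1`, `lda_conj2`, `lda_log_event`, `lda_exp_event`), using `m ≤ α n`,
`e² ≤ 8` and `α ≤ 1/288`. -/
theorem stub_lowDensityAsymptotics (k : ℕ) (hk : 3 ≤ k) (α η c : ℝ) (hα : 0 < α)
    (hαk : α ≤ 1 / (32 * (k : ℝ) ^ 2)) (hη : 0 < η) (hc : 0 < c) :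
    ∀ᶠ n : ℕ in Filter.atTop,
      (k : ℝ) * ((⌊α * n⌋₊ : ℝ) * k + 1) *
          (∑ c' ∈ Finset.Icc 2 ⌊α * n⌋₊, ((⌊α * n⌋₊.choose c' : ℕ) : ℝ) *
            ((n.choose (c' - 1) : ℕ) : ℝ) * (((c' - 1 : ℕ) : ℝ) / n) ^ (k * c')) ≤ 1 / 4 ∧
      (k : ℝ) * (⌊α * n⌋₊ : ℝ) ^ (2 * Nat.log 2 n + 4) * (4 : ℝ) ^ (2 * Nat.log 2 n + 4) *
          ((2 * k : ℝ) ^ 2 / n) ^ (2 * Nat.log 2 n + 4 - 1) ≤ 1 / 4 ∧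
      2 * (k : ℝ) * ((2 * Nat.log 2 n + 4 : ℕ) : ℝ) ≤ η * n ∧
      Real.exp (-(c * n)) ≤ 1 / 2 ∧
      ⌊α * n⌋₊ ≤ n ∧ 1 ≤ n := by
  have hk3 : (3 : ℝ) ≤ k := by exact_mod_cast hk
  have hkpos : (0 : ℝ) < k := by linarith
  have hα1 : α ≤ 1 / 288 :=
    hαk.trans (one_div_le_one_div_of_le (by norm_num) (by nlinarith))
  have hE8 : Real.exp 2 ≤ 8 := by
    have h1 : Real.exp 1 < 272 / 100 := Real.exp_one_lt_d9.trans (by norm_num)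
    have h2 : Real.exp 2 = Real.exp 1 * Real.exp 1 := by rw [← Real.exp_add]; norm_num
    rw [h2]; nlinarith [Real.exp_pos 1]
  have hα8 : Real.exp 2 * α ^ 2 ≤ 1 / 8 := by
    calc Real.exp 2 * α ^ 2 ≤ 8 * (1 / 288) ^ 2 := by gcongr
      _ ≤ 1 / 8 := by norm_num
  filter_upwards [(tendsto_natCast_atTop_atTop (R := ℝ)).eventually_ge_atTop
      (4 * Real.exp 2 * α ^ 3 * k * (α * k + 1)),
    (tendsto_natCast_atTop_atTop (R := ℝ)).eventually_ge_atTop (8 * k * α),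
    lda_log_event (A := 4 * k) (B := 8 * k) (by positivity) hη,
    lda_exp_event hc, Filter.eventually_ge_atTop 1] with n h1 h2 h3 h4 hn
  have hm : ((⌊α * n⌋₊ : ℕ) : ℝ) ≤ α * n := Nat.floor_le (by positivity)
  have hmn : ⌊α * (n : ℝ)⌋₊ ≤ n :=
    Nat.floor_le_of_le (mul_le_of_le_one_left (Nat.cast_nonneg n) (by linarith))
  refine ⟨lda_conj1 hk hα hα8 hn hmn hm h1, lda_conj2 hk hα hαk hn hm h2, ?_, h4, hmn, hn⟩
  push_cast
  linarith [h3]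

end Summit.PneNP.PneNP.Cruxes.SolvableImpliesStableSection.Sketch
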